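import Mathlib.Probability.Martingale.Basic
import Literature.Probability.RandomPlanarGeometry.ObservableDrivingMartingales
import HarnessLib

/-!
# Route `SAWStressTensor`, item `TMartingaleDriver` — part 1: the far-field expansion of the
stress-tensor observable and the approximate-martingale lemma

Support file for item `stmt-CriticalPhenomena-7753` (`TMartingaleDriver`) of route
`SAWStressTensor` (sub-problem `SAWScalingLimit`). The *stress-tensor* (spin-2, `α = 2`)
half-plane observable of a chordal Loewner chain with driving function `W` is the square of the
observable density, `T_t(z) = (z g_t'(z)/(g_t(z) - W_t))²` (Doyon–Riva–Cardy's `⟨T(w)⟩ = h/w²`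
with the weight `h` divided out; Bauer–Bernard's level-two martingale read backwards). This file
proves the deterministic far-field expansion

`‖(z g_t'(z)/(g_t(z) - W_t))² - (1 + 2W_t/z + (3W_t² - 8t)/z²)‖ ≤ 221 ((K + √t)/‖z‖)³`

(`stressTensor_norm_density_sq_sub_le`, by squaring the tree's expansion
`Loewner.FarRegime.norm_density_sub_le` of the density), its pathwise form at the CDHKS stopped
clock `r ∧ τ_y` at the point `z = iy` (`stressTensor_norm_stopped_sub_le`), the separation of
the two coefficients into the imaginary part (`-2W/y`) and the real part (`1 - (3W² - 8t)/y²`)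
on the imaginary axis, and a generic `L¹` lemma (`integral_abs_condExp_sub_le_of_martingale`):
a pair `(A, B)` that is `ε`-close in `L¹` to an affine image `(c X_t + d, c X_s + d)` of a
martingale satisfies `∫ |E[A | 𝓕_s] - B| ≤ 2ε`. Part 2
(`SAWStressTensorTMartingaleDriver.lean`) runs the `y → ∞` argument of the tree's
`Loewner.martingale_driver_of_fkObservable` with these inputs and concludes that `W_t` and
`W_t² - (8/3) t` are martingales: `κ = 8/(α + 1) = 8/3` for `α = 2`.

## References

* D. Chelkak, H. Duminil-Copin, C. Hongler, A. Kemppainen, S. Smirnov, *Convergence of Ising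
  interfaces to Schramm's SLE curves*, C. R. Math. Acad. Sci. Paris 352 (2014), §3 [CDHKSCRAS2014].
* M. Bauer, D. Bernard, *Conformal field theories of stochastic Loewner evolutions*, Comm. Math.
  Phys. 239 (2003) [BauerBernard2003].
* B. Doyon, V. Riva, J. Cardy, *Identification of the stress-energy tensor through conformal
  restriction in SLE and related processes*, Comm. Math. Phys. 268 (2006) [DoyonRivaCardy2006].
-/

noncomputable section

open Set Filter Topology Metric MeasureTheory Complex
open scoped NNReal
open Literature.Probability.RandomPlanarGeometry Literature.Probability.Process

namespace Summit.CriticalPhenomena.SAWScalingLimit.Theorems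

/-! ### The deterministic expansion of the squared density -/

section Deterministic

variable {W : ℝ≥0 → ℝ} {z : ℂ} {t : ℝ≥0} {K : ℝ}

/-- **Far-field expansion of the stress-tensor observable.** In the far-field regime
(`64 (K + √t) ≤ ‖z‖`, `|W| ≤ K` on `[0, t]`),
`‖(z g_t'(z)/(g_t(z) - W_t))² - (1 + 2W_t/z + (3W_t² - 8t)/z²)‖ ≤ 221 ((K + √t)/‖z‖)³`:
with `N = z g_t'/(g_t - W_t) = 1 + ε`, `ε = W_t/z + (W_t² - 4t)/z² + O(α³)`
(`Loewner.FarRegime.norm_density_sub_le`), `N² = 1 + 2ε + ε²` and `ε² = W_t²/z² + O(α³)`.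
This is the `α = 2` member of the family `(z g'/(g - W))^α = 1 + αW/z + …` whose martingale
property forces `κ = 8/(α+1)` (Bauer–Bernard 2003; CDHKS 2014 §3 for `α = 1/2, 1`).
[cite: CDHKSCRAS2014, §3 eq. (5)] -/
theorem stressTensor_norm_density_sq_sub_le (h : Loewner.FarRegime W z t K) :
    ‖(z * deriv (Loewner.map W t) z / (Loewner.map W t z - W t)) ^ 2 -
        (1 + 2 * W t / z + (3 * (W t : ℂ) ^ 2 - 8 * t) / z ^ 2)‖ ≤
      221 * ((K + Real.sqrt t) / ‖z‖) ^ 3 := by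
  obtain ⟨g, hg⟩ := h.exists_sol
  have hK := h.K_le
  have ht := h.t_le
  have hα := h.alpha_le
  have hα0 := h.alpha_nonneg
  have hmain := h.norm_density_sub_le hg
  have hN1 := h.norm_density_sub_one_le
  have hWt : ‖(W t : ℂ)‖ ≤ K := by
    rw [norm_real, Real.norm_eq_abs]
    have := h.bound t ⟨t.coe_nonneg, le_rfl⟩
    rwa [Real.toNNReal_coe] at this
  set α := (K + Real.sqrt t) / ‖z‖ with hαdef
  have hρ := h.pos
  have hz := h.z_ne_zero
  set N := z * deriv (Loewner.map W t) z / (Loewner.map W t z - W t) with hNdef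
  set ε := N - 1 with hεdef
  set w : ℂ := (W t : ℂ) / z with hwdef
  set c : ℂ := ((W t : ℂ) ^ 2 - 4 * t) / z ^ 2 with hcdef
  have hw : ‖w‖ ≤ α := by
    rw [hwdef, norm_div, div_le_iff₀ hρ]; exact hWt.trans hK
  have hc : ‖c‖ ≤ 5 * α ^ 2 := by
    rw [hcdef, norm_div, norm_pow, div_le_iff₀ (by positivity)]
    calc ‖(W t : ℂ) ^ 2 - 4 * t‖ ≤ ‖(W t : ℂ) ^ 2‖ + ‖(4 : ℂ) * t‖ := norm_sub_le _ _
      _ = ‖(W t : ℂ)‖ ^ 2 + 4 * t := by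
          rw [norm_pow, norm_mul]
          congr 1
          rw [Complex.norm_real, Real.norm_eq_abs, abs_of_nonneg t.coe_nonneg]
          simp
      _ ≤ (α * ‖z‖) ^ 2 + 4 * (α ^ 2 * ‖z‖ ^ 2) := by
          gcongr
          exact hWt.trans hK
      _ = 5 * α ^ 2 * ‖z‖ ^ 2 := by ring
  have hR5 : ‖ε - (w + c)‖ ≤ 100 * α ^ 3 := by
    have : ε - (w + c) = N - (1 + W t / z + ((W t : ℂ) ^ 2 - 4 * t) / z ^ 2) := by
      rw [hεdef, hwdef, hcdef]; ring
    rw [this]; exact hmain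
  have hε : ‖ε‖ ≤ 2 * α := hN1
  -- `ε² - w²`
  have hε2 : ‖ε ^ 2 - w ^ 2‖ ≤ 21 * α ^ 3 := by
    have hid : ε ^ 2 - w ^ 2 = (ε - w) * (ε + w) := by ring
    have h1 : ‖ε - w‖ ≤ 7 * α ^ 2 := by
      calc ‖ε - w‖ = ‖(ε - (w + c)) + c‖ := by ring_nf
        _ ≤ ‖ε - (w + c)‖ + ‖c‖ := norm_add_le _ _
        _ ≤ 100 * α ^ 3 + 5 * α ^ 2 := add_le_add hR5 hc
        _ ≤ 7 * α ^ 2 := by nlinarith [pow_le_pow_left₀ hα0 hα 2]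
    have h2 : ‖ε + w‖ ≤ 3 * α := by
      calc ‖ε + w‖ ≤ ‖ε‖ + ‖w‖ := norm_add_le _ _
        _ ≤ 2 * α + α := add_le_add hε hw
        _ = 3 * α := by ring
    rw [hid, norm_mul]
    calc ‖ε - w‖ * ‖ε + w‖ ≤ (7 * α ^ 2) * (3 * α) := by gcongr
      _ = 21 * α ^ 3 := by ring
  -- the identity `N² - main = 2 (ε - (w + c)) + (ε² - w²)`
  have hid : N ^ 2 - (1 + 2 * W t / z + (3 * (W t : ℂ) ^ 2 - 8 * t) / z ^ 2) =
      2 * (ε - (w + c)) + (ε ^ 2 - w ^ 2) := by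
    rw [hεdef, hwdef, hcdef]; field_simp; ring
  rw [hid]
  calc ‖2 * (ε - (w + c)) + (ε ^ 2 - w ^ 2)‖ ≤ ‖2 * (ε - (w + c))‖ + ‖ε ^ 2 - w ^ 2‖ :=
        norm_add_le _ _
    _ = 2 * ‖ε - (w + c)‖ + ‖ε ^ 2 - w ^ 2‖ := by simp
    _ ≤ 2 * (100 * α ^ 3) + 21 * α ^ 3 := by gcongr
    _ = 221 * α ^ 3 := by ring

/-- Real and imaginary parts of the main term of the stress-tensor observable at `z = iy`
(`w`, `s` real): `1 + 2w/(iy) + (3w² - 8s)/(iy)² = (1 - (3w² - 8s)/y²) + (-2w/y) i`.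
[folklore] -/
theorem stressTensor_main_term_eq {y : ℝ} (hy : y ≠ 0) (w s : ℝ) :
    (1 : ℂ) + 2 * (w : ℂ) / (I * y) + (3 * (w : ℂ) ^ 2 - 8 * (s : ℂ)) / (I * y) ^ 2 =
      ((1 - (3 * w ^ 2 - 8 * s) / y ^ 2 : ℝ) : ℂ) + ((-2 * w / y : ℝ) : ℂ) * I := by
  have hy' : (y : ℂ) ≠ 0 := by exact_mod_cast hy
  have h1 : (I * (y : ℂ))⁻¹ = -I * (y : ℂ)⁻¹ := by
    rw [mul_inv, Complex.inv_I]
  have h2 : ((I * (y : ℂ)) ^ 2)⁻¹ = -((y : ℂ) ^ 2)⁻¹ := by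
    rw [mul_pow, I_sq, neg_one_mul, inv_neg]
  push_cast
  simp only [div_eq_mul_inv, h1, h2]
  ring

end Deterministic

/-! ### The stopped observable at `z = iy` -/

section Stopped

variable {Ω : Type*} {m : MeasurableSpace Ω} {W : ℝ≥0 → Ω → ℝ}

/-- **Pathwise expansion of the stopped stress-tensor observable** at `z = iy`: with
`A_r = W_{r∧τ_y}`, `σ_r = r ∧ τ_y` (`τ_y = Loewner.farStopTime W y`) and `|W_u| ≤ M` on `[0, t]`,
`‖T_{σ_r}(iy) - (1 + 2A_r/(iy) + (3A_r² - 8σ_r)/(iy)²)‖ ≤ 221 ((M + √t)/y)³` for `r ≤ t` — the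
far-field expansion at the stopped clock (`Loewner.farRegime_stopped`), with a remainder
uniform in `y` (CDHKS 2014, §3: "the `O`-bounds are uniform with respect to both `t` and
`z`"). [cite: CDHKSCRAS2014, §3 eq. (5)] -/
theorem stressTensor_norm_stopped_sub_le (hWc : ∀ ω, Continuous (W · ω)) (hW0 : ∀ ω, W 0 ω = 0)
    {y : ℝ} (hy : 0 < y) {ω : Ω} {t : ℝ≥0} {M : ℝ} (hM0 : 0 ≤ M) (hM : ∀ u, u ≤ t → |W u ω| ≤ M)
    {r : ℝ≥0} (hr : r ≤ t) :
    ‖stoppedProcess (fun r ω ↦ (I * y * deriv (Loewner.map (fun u ↦ W u ω) r) (I * y) /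
          (Loewner.map (fun u ↦ W u ω) r (I * y) - W r ω)) ^ 2) (Loewner.farStopTime W y) r ω -
        (1 + 2 * ((stoppedProcess W (Loewner.farStopTime W y) r ω : ℝ) : ℂ) / (I * y) +
          (3 * ((stoppedProcess W (Loewner.farStopTime W y) r ω : ℝ) : ℂ) ^ 2 -
              8 * ((((min (r : WithTop ℝ≥0) (Loewner.farStopTime W y ω)).untopA : ℝ≥0) : ℝ) : ℂ)) /
            (I * y) ^ 2)‖ ≤
      221 * ((M + Real.sqrt t) / y) ^ 3 := by
  have hreg := Loewner.farRegime_stopped hWc hW0 hy hM hr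
  set σ := (min (r : WithTop ℝ≥0) (Loewner.farStopTime W y ω)).untopA with hσ
  have hσt : σ ≤ t := (untopA_min_coe_le r _).trans hr
  have hmain := stressTensor_norm_density_sq_sub_le hreg
  have hnorm : ‖I * (y : ℂ)‖ = y := by simp [abs_of_pos hy]
  rw [hnorm] at hmain
  refine (le_of_eq ?_).trans (hmain.trans ?_)
  · rfl
  · have hK : min M (y / 128) + Real.sqrt σ ≤ M + Real.sqrt t := by
      gcongr
      · exact min_le_left _ _
    have hK0 : 0 ≤ min M (y / 128) + Real.sqrt σ :=
      add_nonneg (le_min hM0 (by positivity)) (Real.sqrt_nonneg _)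
    gcongr

/-- **Imaginary part: the first coefficient.** On the imaginary axis the first-order term
`2W/z` of the stress-tensor observable is purely imaginary:
`|Im T_{σ_r}(iy) + 2A_r/y| ≤ 221 ((M + √t)/y)³`. [folklore] -/
theorem stressTensor_abs_im_stopped_add_le (hWc : ∀ ω, Continuous (W · ω))
    (hW0 : ∀ ω, W 0 ω = 0) {y : ℝ} (hy : 0 < y) {ω : Ω} {t : ℝ≥0} {M : ℝ} (hM0 : 0 ≤ M)
    (hM : ∀ u, u ≤ t → |W u ω| ≤ M) {r : ℝ≥0} (hr : r ≤ t) :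
    |(stoppedProcess (fun r ω ↦ (I * y * deriv (Loewner.map (fun u ↦ W u ω) r) (I * y) /
          (Loewner.map (fun u ↦ W u ω) r (I * y) - W r ω)) ^ 2) (Loewner.farStopTime W y) r ω).im +
        2 * stoppedProcess W (Loewner.farStopTime W y) r ω / y| ≤
      221 * ((M + Real.sqrt t) / y) ^ 3 := by
  have h := stressTensor_norm_stopped_sub_le hWc hW0 hy hM0 hM hr
  rw [stressTensor_main_term_eq hy.ne'] at h
  set a : ℝ := 1 - (3 * stoppedProcess W (Loewner.farStopTime W y) r ω ^ 2 -
      8 * ((min (r : WithTop ℝ≥0) (Loewner.farStopTime W y ω)).untopA : ℝ)) / y ^ 2 with ha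
  set b : ℝ := -2 * stoppedProcess W (Loewner.farStopTime W y) r ω / y with hb
  set O := stoppedProcess (fun r ω ↦ (I * y * deriv (Loewner.map (fun u ↦ W u ω) r) (I * y) /
      (Loewner.map (fun u ↦ W u ω) r (I * y) - W r ω)) ^ 2) (Loewner.farStopTime W y) r ω with hO
  have him : (O - ((a : ℂ) + (b : ℂ) * I)).im =
      O.im + 2 * stoppedProcess W (Loewner.farStopTime W y) r ω / y := by
    simp only [sub_im, add_im, ofReal_im, mul_im, ofReal_re, I_re, I_im, mul_zero, mul_one,
      zero_add, add_zero, hb]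
    ring
  rw [← him]
  exact (abs_im_le_norm _).trans h

/-- **Real part: the second coefficient.** On the imaginary axis the second-order term
`(3W² - 8t)/z²` of the stress-tensor observable is purely real:
`|Re T_{σ_r}(iy) - 1 + (3A_r² - 8σ_r)/y²| ≤ 221 ((M + √t)/y)³`, so the two coefficients separate
and no optional stopping is needed to peel them off. [folklore] -/
theorem stressTensor_abs_re_stopped_sub_le (hWc : ∀ ω, Continuous (W · ω))
    (hW0 : ∀ ω, W 0 ω = 0) {y : ℝ} (hy : 0 < y) {ω : Ω} {t : ℝ≥0} {M : ℝ} (hM0 : 0 ≤ M)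
    (hM : ∀ u, u ≤ t → |W u ω| ≤ M) {r : ℝ≥0} (hr : r ≤ t) :
    |(stoppedProcess (fun r ω ↦ (I * y * deriv (Loewner.map (fun u ↦ W u ω) r) (I * y) /
          (Loewner.map (fun u ↦ W u ω) r (I * y) - W r ω)) ^ 2) (Loewner.farStopTime W y) r ω).re -
        1 + (3 * stoppedProcess W (Loewner.farStopTime W y) r ω ^ 2 -
          8 * ((min (r : WithTop ℝ≥0) (Loewner.farStopTime W y ω)).untopA : ℝ)) / y ^ 2| ≤
      221 * ((M + Real.sqrt t) / y) ^ 3 := by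
  have h := stressTensor_norm_stopped_sub_le hWc hW0 hy hM0 hM hr
  rw [stressTensor_main_term_eq hy.ne'] at h
  set a : ℝ := 1 - (3 * stoppedProcess W (Loewner.farStopTime W y) r ω ^ 2 -
      8 * ((min (r : WithTop ℝ≥0) (Loewner.farStopTime W y ω)).untopA : ℝ)) / y ^ 2 with ha
  set b : ℝ := -2 * stoppedProcess W (Loewner.farStopTime W y) r ω / y with hb
  set O := stoppedProcess (fun r ω ↦ (I * y * deriv (Loewner.map (fun u ↦ W u ω) r) (I * y) /
      (Loewner.map (fun u ↦ W u ω) r (I * y) - W r ω)) ^ 2) (Loewner.farStopTime W y) r ω with hO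
  have hre : (O - ((a : ℂ) + (b : ℂ) * I)).re = O.re - 1 +
      (3 * stoppedProcess W (Loewner.farStopTime W y) r ω ^ 2 -
        8 * ((min (r : WithTop ℝ≥0) (Loewner.farStopTime W y ω)).untopA : ℝ)) / y ^ 2 := by
    simp only [sub_re, add_re, ofReal_re, mul_re, ofReal_im, I_re, I_im, mul_zero, mul_one,
      sub_zero, ha]
    ring
  rw [← hre]
  exact (abs_re_le_norm _).trans h

end Stopped

/-! ### The approximate-martingale comparison lemma -/

section Approx

variable {Ω : Type*} {m : MeasurableSpace Ω} {P : Measure Ω} [IsFiniteMeasure P]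
  {𝓕 : Filtration ℝ≥0 m}

/-- **`L¹`-comparison with an affine image of a martingale.** If `X` is an `𝓕`-martingale and
the integrable pair `(A, B)` satisfies `∫ |A - (c X_t + d)| ≤ ε` and `∫ |B - (c X_s + d)| ≤ ε`
for some constants `c`, `d` and `s ≤ t`, then `∫ |E[A | 𝓕_s] - B| ≤ 2ε`: write
`E[A | 𝓕_s] - B = E[A - Y_t | 𝓕_s] + (Y_s - B)` with `Y = c X + d` (so `E[Y_t | 𝓕_s] = Y_s`)
and use `L¹`-contractivity of conditional expectation. This is the form in which "we can
exchange the asymptotic expansion with the conditional expectation" (CDHKS 2014, §3) is used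
for each coefficient. [folklore] -/
theorem integral_abs_condExp_sub_le_of_martingale {X : ℝ≥0 → Ω → ℝ} (hX : Martingale X 𝓕 P)
    (c d : ℝ) {A B : Ω → ℝ} (hA : Integrable A P) (hB : Integrable B P) {s t : ℝ≥0}
    (hst : s ≤ t) {ε : ℝ} (ht : ∫ ω, |A ω - (c * X t ω + d)| ∂P ≤ ε)
    (hs : ∫ ω, |B ω - (c * X s ω + d)| ∂P ≤ ε) :
    ∫ ω, |(P[A | 𝓕 s]) ω - B ω| ∂P ≤ 2 * ε := by
  set Y : ℝ≥0 → Ω → ℝ := fun r ω ↦ c * X r ω + d with hY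
  have hYi : ∀ r, Integrable (Y r) P := fun r ↦
    ((hX.integrable r).const_mul c).add (integrable_const d)
  -- `E[Y_t | 𝓕_s] = Y_s`
  have hYm : P[Y t | 𝓕 s] =ᵐ[P] Y s := by
    have h1 : P[Y t | 𝓕 s] =ᵐ[P] P[fun ω ↦ c * X t ω | 𝓕 s] + P[fun _ ↦ d | 𝓕 s] :=
      condExp_add ((hX.integrable t).const_mul c) (integrable_const d) _
    have h2 : P[fun ω ↦ c * X t ω | 𝓕 s] =ᵐ[P] fun ω ↦ c * X s ω := by
      have : (fun ω ↦ c * X t ω) = c • X t := by ext ω; simp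
      rw [this]
      filter_upwards [condExp_smul c (X t) (𝓕 s) (μ := P), hX.2 s t hst] with ω hω hω'
      simp [hω, hω']
    have h3 : P[fun _ ↦ d | 𝓕 s] = fun _ ↦ d := condExp_const (𝓕.le s) _
    filter_upwards [h1, h2] with ω hω1 hω2
    rw [hω1, Pi.add_apply, hω2, h3]
  -- split `A = (A - Y_t) + Y_t`
  have hsplit : P[A | 𝓕 s] =ᵐ[P] P[A - Y t | 𝓕 s] + P[Y t | 𝓕 s] := by
    have := condExp_add (hA.sub (hYi t)) (hYi t) (𝓕 s) (μ := P)
    rwa [sub_add_cancel] at this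
  have hcontr : ∫ ω, |(P[A - Y t | 𝓕 s]) ω| ∂P ≤ ∫ ω, |(A - Y t) ω| ∂P :=
    integral_abs_condExp_le _
  have hF : Integrable (P[A - Y t | 𝓕 s]) P := integrable_condExp
  have hG : Integrable (fun ω ↦ Y s ω - B ω) P := (hYi s).sub hB
  calc ∫ ω, |(P[A | 𝓕 s]) ω - B ω| ∂P
      = ∫ ω, |(P[A - Y t | 𝓕 s]) ω + (Y s ω - B ω)| ∂P := by
        refine integral_congr_ae ?_
        filter_upwards [hsplit, hYm] with ω hω1 hω2
        rw [hω1, Pi.add_apply, hω2, add_sub_assoc]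
    _ ≤ ∫ ω, (|(P[A - Y t | 𝓕 s]) ω| + |Y s ω - B ω|) ∂P :=
        integral_mono (hF.add hG).abs (hF.abs.add hG.abs) fun ω ↦ abs_add_le _ _
    _ = ∫ ω, |(P[A - Y t | 𝓕 s]) ω| ∂P + ∫ ω, |Y s ω - B ω| ∂P := integral_add hF.abs hG.abs
    _ ≤ ε + ε := by
        refine add_le_add (hcontr.trans ?_) ?_
        · simpa [hY] using ht
        · calc ∫ ω, |Y s ω - B ω| ∂P = ∫ ω, |B ω - (c * X s ω + d)| ∂P :=
                integral_congr_ae (ae_of_all _ fun ω ↦ abs_sub_comm _ _)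
            _ ≤ ε := hs
    _ = 2 * ε := by ring

end Approx

end Summit.CriticalPhenomena.SAWScalingLimit.Theorems
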